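import Summits.Ventures.AbcShadow.SH04.LStar

/-!
# Venture AbcShadow — [BD10] `(d, p) = (13, 7)`: the LINKED package, the two NAMED exclusion kinds, the allowed sets at `q = 43`,
# and the traces of 5200bc1 (kernel bookkeeping for a sanity slice)

HONEST FRAMING. Interface file of the work-bound cell `abc-shadow` (typer seat `abc-shadow-typ-1`, lineage g4). NOTHING in this
file is a theorem about a Diophantine equation; nothing here is a claim on abc or on any summit; no side on IUT. Context: the
cell's COMPUTED + INDEPENDENTLY RE-CHECKED closure of `x⁵ + y⁵ = 13 z⁷` (row SH-04, pair `(13, 7)` of [BD10] = N. Billerey,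
L. V. Dieulefait, Math. Comp. 79 (2010) 535–544; print has `p ≥ 19`). At `p = 7` the [BD10, Prop 1.1] trace sieve over the
110 newform orbits of levels `650, 2600, 5200` (certificate 4a36c28685fe0350 part D; eng-2 g2 signing package certificate-mu4
2a3123ab9c93facf) leaves EIGHT survivors (crit-1-L2-SH04.md (1); certificate-mu4 record `SURVIVORS|13|7`): the seven RATIONAL
orbits 650.1/.3/.9, 2600.11, 5200.28/.29/.30 — the traces of the Cremona classes 650m, 650f, 650i, 2600b, 5200m, 5200bc, 5200bk —
and the degree-2 orbit 5200.42 at its prime `λ = (7, θ − 4)` only. Print's method removes them by two LOCAL arguments which the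
abstract newform interface of `Summits/Ventures/AbcSig` (traces only) cannot express; they therefore enter the row
`SH04/RowBD13_7.lean` as NAMED HYPOTHESES, typed here in the per-orbit-exclusion style of `Summit.Ventures.AbcSig.NewformModel.Excludes`:

* (A1, inertia at 5 — CITED + COMPUTED) `BD10NewformModel.ExcludesAt7 N o`: a putative non-trivial primitive solution
  `(a, b, c)` gives the Frey curve `W = E(a,b)` of [BD10, (1.1)] with `#ρ̄_{W,7}(I₅) ∈ {4, 14}` — [Bil07 = Billerey, Bull. Austral.
  Math. Soc. 76 (2007) 161–194, Lemme 2.8 (reduction type at 5) + Lemme 4.1, p. 176: `e = 4` if `5 ∤ a + b`, `e = 2p` if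
  `5 ∣ a + b`, the exception `(p, v₅(d)) ∈ {(7,3), (11,4)}` not firing for `d = 13`]; if `ρ̄_{W,7} ≅ ρ̄_{F,7}` for the (modular,
  [Cre97]-listed) elliptic curve `F` of one of the seven classes, then `#ρ̄_{W,7}(I₅)` divides `e₅(F) = 12 / gcd(12, v₅(Δ_min(F)))`
  (potentially good reduction, Serre–Tate / Kraus) `∈ {3, 2, 6, 6, 3, 2, 3}` — impossible. COMPUTED parts: the identification
  orbit ↔ Cremona class by traces (crit-1 g1, own point counts at 15 primes) and the seven `e₅` (crit-1-L2-SH04.md (2), verdict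
  "(A1) SOUND"); certificate-mu2c.txt 766bd67a184b9b8e repeats the repair "divides `e₅`" for reducible classes.
* (R1, the λ-exclusion of 5200.42 — COMPUTED + CITED, L\*-shaped, NOT print, NOT kernel) `BD10NewformModel.ExcludesModAt7 N o r`:
  the newform `f = 5200.42` satisfies `a_n(f) ≡ a_n(f_{E′}) (mod λ)`, `λ = (7, θ − 4)`, `E′ = 5200bc1 = [0,0,0,−1075,−20750]`, for
  all `n ≤ 1680` = the Sturm bound of `Γ₀(5200)` (COMPUTED: eng-2 g3 kit j320425, certificate-mu2c 766bd67a184b9b8e; INDEPENDENTLY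
  RE-CHECKED: crit-1 g3 blind j320346, 260 primes, own curve side), hence for all `n` [Sturm 1987, Thm 1], hence
  `ρ̄_{f,λ}^ss ≅ ρ̄_{E′,7}^ss` (Chebotarev + Brauer–Nesbitt); and `ρ̄_{E′,7}^ss ≅ χ₋₂₀ ⊕ χ₋₂₀·ω` is REDUCIBLE (`E′ ≅ 26b1 ⊗ χ₋₂₀`,
  26b1 has a rational point of order 7 — crit-1-SH04-137-K3.md §2, exact arithmetic), whereas `ρ̄_{W,7}` is IRREDUCIBLE
  [Bil07, Prop 3.1, p. 173]. So Ribet's newform attached to `W` cannot be `5200.42` with its congruences through `λ`. The kernel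
  proves separately (`SH04/Level5200s7b.lean`, distinguished-prime certificate of `SH04/LStar.lean`) that `λ` is the ONLY prime
  of that orbit which can carry the [Prop 1.1] congruences, and re-checks the first terms of the congruence (`q ≤ 43`) against
  the traces of `E′` computed below by point counting — a SANITY SLICE, not a substitute for the Sturm-bound certificate.

To state per-orbit exclusions one needs the LINK "this `f` is the newform attached to THIS solution" which the landed package
`BD10Package13` (file `SH04/BD10Package.lean`: `∃ N ∈ {650,2600,5200}, ∃ f, ArisesMod f p S`) elides. Exactly as
`Summit.Ventures.AbcSig.NewformModel` carries the uninterpreted relation `Arises` for signature `(n,n,2)`, this file extends the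
interface by ONE uninterpreted relation `AttachedBD10 d p a b c N f` = "[BD10, p. 1]: `σ_{f,𝔭} ≡ ρ_p (mod 𝔭)` for the Frey curve
`E(a,b)` of the solution `(a,b,c)` of `x⁵ + y⁵ = d z^p` and the newform `f` of level `N` (some prime `𝔭 ∣ p` of `K_f`)" and
re-types the SAME printed package in linked form (`BD10NewformModel.Package13L`; `package13_of_linked` shows it yields the landed
`BD10Package13` verbatim). No instance, no axiom, no notation. MEANINGFUL ONLY FOR THE INTENDED MODEL. Also here: the allowed
sets tabulated at one more prime, `q = 43` (`bd10AllowedTab7`, `A₄₃` CERTIFIED by the kernel), used by three rational orbits'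
trees, and `matchesModAt`-free bookkeeping. References: [BD10]; [Bil07]; [Sturm 1987] J. Sturm, LNM 1240; [Cre97] Cremona's
tables (offline subset 23144c64c32091ab used by the engine/critic; labels 650m … 5200bk, 5200bc1, 26b1). AI-typed; weaker than
expert refereeing.
-/

namespace Summit.Ventures.AbcShadow

open Summit.Ventures.AbcSig (NewformModel OrbitData)

/-! ## The allowed sets with `q = 43` tabulated -/

/-- `bd10AllowedTab` (file `SH04/BD10Package.lean`) with ONE more literal entry: `S₄₃ = {±44} ∪ A₄₃`,
`A₄₃ = {−12, −8, −6, −4, −2, 0, 2, 6, 8, 10}` (the Frey-trace set of [BD10 §2] at `q = 43`, not printed there; computed here and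
RE-COMPUTED by the kernel in `bd10AllowedTab7_spec_43`). Used so that the three mod-7 trees at `q = 43` evaluate cheaply.
[cite: BillereyDieulefait2010, Prop 1.1 and §2 (tabulated)] -/
def bd10AllowedTab7 (q : ℕ) : List ℤ :=
  if q = 43 then [44, -44, -12, -8, -6, -4, -2, 0, 2, 6, 8, 10] else bd10AllowedTab q

/-- `S₄₃ ⊆ bd10AllowedTab7 43`, by kernel evaluation of the point counts (this CERTIFIES `A₄₃ = {−12, −8, −6, −4, −2, 0, 2, 6, 8, 10}`).
[cite: BillereyDieulefait2010, §2 (the recipe), value computed here] -/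
theorem bd10AllowedTab7_spec_43 : ∀ t ∈ bd10AllowedSpec 43, t ∈ bd10AllowedTab7 43 := by
  decide +kernel

/-- `S_q ⊆ bd10AllowedTab7 q` for every `q` (at `43` by `bd10AllowedTab7_spec_43`, elsewhere `bd10AllowedTab_spec`).
[cite: BillereyDieulefait2010, Prop 1.1 and §2 (tabulated)] -/
theorem bd10AllowedTab7_spec : ∀ q : ℕ, ∀ t ∈ bd10AllowedSpec q, t ∈ bd10AllowedTab7 q := by
  intro q
  by_cases q43 : q = 43
  · subst q43; exact bd10AllowedTab7_spec_43
  intro t ht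
  have htab : bd10AllowedTab7 q = bd10AllowedTab q := by
    unfold bd10AllowedTab7
    rw [if_neg q43]
  rw [htab]
  exact bd10AllowedTab_spec q t ht

/-! ## The linked interface and the [BD10] package in linked form -/

/-- **Extended abstract newform interface for [BD10] rows with per-orbit exclusions.** `Summit.Ventures.AbcSig.NewformModel`
plus ONE uninterpreted relation: `AttachedBD10 d p a b c N f` = "the mod-`p` representation `ρ_p` of the Frey curve `E(a,b)` of
[BD10, (1.1)] attached to the solution `(a, b, c)` of `x⁵ + y⁵ = d z^p` arises from the newform `f` of weight 2, level `N`, trivial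
character: `σ_{f,𝔭} ≡ ρ_p (mod 𝔭)` for a prime `𝔭 ∣ p` of `K_f`" ([BD10, p. 1, the displayed consequence of Ribet's theorem]) — the
`(5,5,p)` analogue of `NewformModel.Arises`. MEANINGFUL ONLY FOR THE INTENDED MODEL. No instance is declared.
[cite: BillereyDieulefait2010, §1 p.1 (vocabulary: 'σ_{f,p} ≡ ρ_p (mod p)')] -/
structure BD10NewformModel extends Summit.Ventures.AbcSig.NewformModel where
  /-- `AttachedBD10 d p a b c N f`: `ρ_p` of `E(a,b)` (solution `(a,b,c)` of `x⁵ + y⁵ = d z^p`) arises from `f` of level `N` -/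
  AttachedBD10 : (d p : ℕ) → ℤ → ℤ → ℤ → (N : ℕ) → Form N → Prop

/-- **NAMED HYPOTHESIS [BD10, §1 + Prop 1.1 + §2, with [Bil07] for `d = 13`] in LINKED form** (`M.Package13L`): for a prime
`p ≥ 7`, `p ≠ 13`, and a non-trivial primitive solution `(a, b, c)` of `x⁵ + y⁵ = 13 z^p`: (i) `ρ_p` of `E(a,b)` is attached to some
newform `f` of weight 2, trivial character and level `N ∈ {650, 2600, 5200}` — [BD10 §3.3: "It follows from [Bil07], that the
representation `ρ_p` is irreducible, of weight `k = 2` (since `p ≠ 13`) and level `N(ρ_p) = 650, 2600` or `5200`" + Ribet, p. 1];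
(ii) whenever `ρ_p` is attached to `f`, the [Prop 1.1 + §2] congruences hold: `a′_q ≡ ±(q+1)` or `a′_q ≡ a_q(E(a,b) mod q) ∈ A_q`
modulo one prime above `p`, for every odd prime `q ≠ p` not dividing the level — `M.ArisesMod f p bd10AllowedSpec`. The SAME print
content as the landed `BD10Package13` (`package13_of_linked`), with the attachment made referable. CITED, never proved here;
the row takes `(hP : M.Package13L)`. [cite: BillereyDieulefait2010, Prop 1.1, §2, §3.3 (levels 650/2600/5200 via Billerey2007); p.1 (Ribet)] -/
def BD10NewformModel.Package13L (M : BD10NewformModel) : Prop :=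
  ∀ (p : ℕ) (a b c : ℤ), p.Prime → 7 ≤ p → p ≠ 13 → IsBD10Solution 13 p a b c →
    (∃ N : ℕ, (N = 650 ∨ N = 2600 ∨ N = 5200) ∧ ∃ f : M.Form N, M.AttachedBD10 13 p a b c N f) ∧
    (∀ (N : ℕ) (f : M.Form N), M.AttachedBD10 13 p a b c N f → M.ArisesMod f p bd10AllowedSpec)

/-- Bookkeeping: the linked package yields the landed (unlinked) `BD10Package13` of `SH04/BD10Package.lean` verbatim — it types
the same print content, with the attached newform made referable. [cite: BillereyDieulefait2010, Prop 1.1] -/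
theorem BD10NewformModel.package13_of_linked (M : BD10NewformModel) (h : M.Package13L) :
    BD10Package13 M.toNewformModel := by
  intro p a b c hp h7 h13 hsol
  obtain ⟨⟨N, hN, f, hf⟩, hmod⟩ := h p a b c hp h7 h13 hsol
  exact ⟨N, hN, f, hmod N f hf⟩

/-! ## The two named exclusion kinds at `p = 7` -/

/-- **NAMED HYPOTHESIS KIND (A1 — inertia at 5; CITED [Bil07 L.2.8 + L.4.1] + COMPUTED `e₅`)** `M.ExcludesAt7 N o`: for every
non-trivial primitive solution `(a, b, c)` of `x⁵ + y⁵ = 13 z⁷`, NO newform `f` of level `N` matching the orbit data `o` has `ρ₇`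
of `E(a,b)` attached to it. The row assumes this ONLY for the seven rational trace-survivors `o ∈ {650.1, 650.3, 650.9, 2600.11,
5200.28, 5200.29, 5200.30}` (data in `SH04/Level650s7.lean`, `Level2600s7.lean`, `Level5200s7a.lean`), whose traces are those
of the Cremona classes `650m, 650f, 650i, 2600b, 5200m, 5200bc, 5200bk` with `e₅ = 3, 2, 6, 6, 3, 2, 3`: `ρ̄_{W,7} ≅ ρ̄_{F,7}^{(ss)}`
would force `#ρ̄_{W,7}(I₅) ∈ {4, 14}` [Bil07, Lemme 2.8 + Lemme 4.1 p.176] to divide `e₅(F) ∈ {2, 3, 6}` — impossible (module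
docstring; crit-1-L2-SH04.md "(A1) SOUND"). Not provable in this interface; never proved here.
[cite: Billerey2007, Lemme 2.8 and Lemme 4.1 p.176 (image of inertia at 5 of the Frey curve); Prop 3.1 p.173] -/
def BD10NewformModel.ExcludesAt7 (M : BD10NewformModel) (N : ℕ) (o : OrbitData) : Prop :=
  ∀ a b c : ℤ, IsBD10Solution 13 7 a b c → ∀ f : M.Form N, M.Matches f o → ¬ M.AttachedBD10 13 7 a b c N f

/-- **NAMED HYPOTHESIS KIND (R1 — the λ-exclusion; COMPUTED Sturm congruence + CITED [Sturm 1987], [Bil07 Prop 3.1]; L\*-shaped,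
NOT print, NOT kernel)** `M.ExcludesModAt7 N o r`: for every non-trivial primitive solution `(a, b, c)` of `x⁵ + y⁵ = 13 z⁷` and
every newform `f` of level `N` to which `ρ₇` of `E(a,b)` is attached, the [BD10, Prop 1.1] congruences of `f` (print's sets
`bd10AllowedSpec`) do NOT hold through the orbit data `o` modulo a prime through which `θ ≡ r` (`¬ MatchesModAt … o 7 … r`, file
`SH04/LStar.lean`). The row assumes this ONLY at `(N, o, r) = (5200, orbit7_5200_42, 4)`, i.e. for `f = 5200.42` and
`λ = (7, θ − 4)`: there `ρ̄_{f,λ}^ss ≅ ρ̄_{5200bc1,7}^ss = χ₋₂₀ ⊕ χ₋₂₀·ω` is reducible (COMPUTED congruence to the Sturm bound 1680,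
eng-2 j320425 / crit-1 blind j320346; 5200bc1 = 26b1 ⊗ χ₋₂₀) while `ρ̄_{W,7}` is irreducible [Bil07, Prop 3.1] and the attachment
prime satisfies the congruences (module docstring, branch R1 of crit-1-SH04-137-K3.md). Not provable in this interface; never
proved here. [cite: Billerey2007, Prop 3.1 p.173 (irreducibility of ρ̄_{W,p}, p ≥ 7); Sturm1987, Thm 1 (the cited transfer of the computed congruence)] -/
def BD10NewformModel.ExcludesModAt7 (M : BD10NewformModel) (N : ℕ) (o : OrbitData) (r : ℤ) : Prop :=
  ∀ a b c : ℤ, IsBD10Solution 13 7 a b c → ∀ f : M.Form N, M.AttachedBD10 13 7 a b c N f →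
    ¬ MatchesModAt M.toNewformModel f o 7 bd10AllowedSpec r

/-! ## Kernel bookkeeping for the sanity slice: traces of 5200bc1 by point counting -/

/-- The trace of Frobenius `a_q` of the short Weierstrass curve `y² = x³ + a₄ x + a₆` at an odd prime `q` of good reduction,
COMPUTED IN THE KERNEL by point counting: `a_q = −Σ_{x mod q} χ_q(x³ + a₄x + a₆)` (`legendreSymZ` of `SH04/BD10Package.lean`). [folklore] -/
def ecTraceW (a₄ a₆ : ℤ) (q : ℕ) : ℤ :=
  -(((List.range q).map fun x : ℕ => legendreSymZ ((x : ℤ) ^ 3 + a₄ * x + a₆) q).sum)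

/-- `a_q(5200bc1)`, `5200bc1 = [0, 0, 0, −1075, −20750]` (Cremona; `= 208d1 ⊗ χ₅ = 26b1 ⊗ χ₋₂₀`, crit-1-SH04-137-K3.md §1–2), by kernel
point counting. [folklore] -/
def trace5200bc1 (q : ℕ) : ℤ := ecTraceW (-1075) (-20750) q

/-- The traces of 5200bc1 at the odd primes `3 ≤ q ≤ 43`, `q ∉ {5, 7, 13}`: `−3, 2, 3, −6, −4, 2, −4, −3, 0, −5` at
`q = 3, 11, 17, 19, 23, 29, 31, 37, 41, 43` (kernel evaluation; they are the engine's `c_q` of the rational orbit 5200.29 = 5200bc,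
certificate-mu4 2a3123ab9c93facf, and crit-1's own point counts). [folklore] -/
theorem trace5200bc1_values :
    ([3, 11, 17, 19, 23, 29, 31, 37, 41, 43] : List ℕ).map trace5200bc1 = [-3, 2, 3, -6, -4, 2, -4, -3, 0, -5] := by
  decide +kernel

/-- **Sanity slice of the REDUCIBILITY of `ρ̄_{5200bc1,7}`** (kernel; the statement for all `q` is crit-1-SH04-137-K3.md §2, exact
arithmetic with the 7-torsion of 26b1): `a_q(5200bc1) ≡ (−5/q)·(q + 1) (mod 7)` at every listed `q ≤ 43` — the trace of
`χ₋₂₀ ⊕ χ₋₂₀·ω` (`(−20/q) = (−5/q)` for odd `q`). [folklore] -/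
theorem trace5200bc1_reducible_slice :
    ∀ q ∈ ([3, 11, 17, 19, 23, 29, 31, 37, 41, 43] : List ℕ),
      (trace5200bc1 q - legendreSymZ (-5) q * ((q : ℤ) + 1)) % 7 = 0 := by
  decide +kernel

end Summit.Ventures.AbcShadow
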